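import Summits.BirchSwinnertonDyer.BirchSwinnertonDyer.Theorems.SchneiderFreeAdditiveX3KYBranchThreeOfPrint
import Summits.BirchSwinnertonDyer.BirchSwinnertonDyer.Theorems.SchneiderFreeAdditiveX3GordTwoBranchIMCOfKYBranchOnly
import HarnessLib

/-!
# Route `SchneiderFreeAdditiveX3` (K1 door): the (G-ord, `e = 2`) LOWER socket AT `p = 3` for a NON-ANOMALOUS twist, per Heegner datum,
# for a Keller–Yin-normalised curve — from Kolyvagin ∧ Hsieh ∧ LZZ ∧ Castella–Hsieh (signed) ∧ [DIV.dvd] ∧ the typed `p = 3` analytic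
# inputs [AN3] (PUB-composed) and [BR3] (PUB) ∧ eleven published facts ∧ the existence of the analytic comparison data (AUX3)

Cell `bsd-schneider-ideate`, seat `bsd-schneider-door-c5` (prover, generation 26; assembly layer; `--supports` 19177).
PARTITION: board row B6 ∩ X3 ∩ sst-twist, `r = 1`, (G-ord, `e = 2`) half at `p = 3` (2 411 pairs; the 686 NON-ANOMALOUS ones) of
`Rank1Residual.partition` — types-the-object-of nothing new; RE-KEYS generation 21's per-datum door (`…KYBranchOnly` §3–§4: H3♭ᶜ and
`AdditiveIMCLowerBDPOnTreeLeAt` from Keller–Yin's TWO typed clauses KYb, KYμ) at `p = 3` onto {[DIV.dvd], [AN3], [BR3]} + published facts,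
for the curve ITSELF Keller–Yin-normalised (no isogeny descent); closes none of B6's cells (BSD NOT advanced).  bears_on: K1-door (19177 r3).

WHAT.  Generation 21 derived, at every Heegner datum with `d_K ≠ −3`, `AdditiveIMCLowerBDPOnTreeLeAt p κ 𝔭 γ ι_𝔭 (v_p c) P` from Kolyvagin,
Hsieh 2014 Thm. A, Liu–Zhang–Zhang 2018, Castella–Hsieh's signed frame and the two Keller–Yin clauses `thm351_charIdeal_eq_branch_OPEN` (KYb)
and `thm351_mu_zero_branch_OPEN` (KYμ), through H3♭ᶜ = "`Ch_Λ(X_ac^∅(W_K) at 𝔭)·𝓞_{ℂ_p}⟦T⟧ ⊆ (Q)` for every ♭-frame `Q` at the conjugate prime".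
Generation 26's `KYBranchThree.xac_charIdeal_map_eq_span_three_of_dvd` gives KYb's conclusion (and KYμ's) at `p = 3` for a curve of the
(G-ord) cell with a NON-ANOMALOUS twist from [DIV.dvd] + [AN3] + [BR3] + eleven published facts, GIVEN the analytic comparison data at the
datum (a residual pair of `W_K[3]` whose `3`-unramified member carries a Hecke character and a Katz frame).  This file substitutes:
* §1 **`xac_charIdeal_map_le_span_three_self_of_dvd`** — H3♭ᶜ at every ♭-frame of the conjugate prime for the door's PRESENTED curve
  `W = C₂ • ((D • W′) ⊗ χ_{−3})`, `W` ITSELF Keller–Yin-normalised (Case (I), `W[3]` reducible, a rational `3`-line non-trivial on `D_3`,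
  `W(K)[3] = 0`), in the (G-ord) cell with NAT: generation 21's §3 with `W₁ = W` and (hKYb, hKYμ) replaced by (hDVD, hAN, hBR, 11 PUB, AUX).
* §2 **`additiveIMCLowerBDPOnTree_subGordTwo_three_offSliver_self`** — the (G-ord, `e = 2`) lower socket at `p = 3` OFF the `d_K = −3` sliver,
  at every Heegner datum of a globally minimal `W` with `r_an = 1`, `ClassX3 W 3`, `SubGordTwo W 3`, NAT, `W` Keller–Yin-normalised at that
  datum, GIVEN the comparison data at every conjugate prime (hypothesis `hAUX`) ⟸ Kolyvagin ∧ modularity ∧ Hsieh A ∧ LZZ ∧ Castella–Hsieh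
  signed ∧ [DIV.dvd] ∧ [AN3] ∧ [BR3] ∧ eleven published facts — generation 21's §4 with the same substitution.

INPUT LEDGER (G-ord, `e = 2`), `p = 3` ∧ NAT, Keller–Yin-normalised curve, per datum: PUBLISHED facts ∪ {[DIV.dvd] (PREPRINT, at `p = 3`
beyond its printed range), [AN3] (PUB-composed, audit pending)} ∪ {AUX3: existence of the comparison data — a residual pair (tree, from the
rational line), the Hecke character of its `3`-unramified member (class field theory, tree pattern `EisensteinPrimesGoodLatticeHeckeCharOfTeichmuller`),
a Katz frame of it (CGLS Thm. 2.1.2 = x1's `KatzLFunctionExistsFor`, PUBLISHED existence); displayed, not discharged here}.  The non-normalised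
curves of the class need generation 21's isogeny descent (`xac_charIdeal_map_le_of_ratIsogeny`, `μ = 0` of the good member from CGLS Prop. 14)
— plumbing left to a successor (memo FINDING-door-c5-g26 §4).

HONEST FRAMING: compositions of tree theorems, CONDITIONAL on the displayed hypotheses; no definition, no named fact introduced here, no
`sorry`; nothing is closed; BSD proved for no curve; «closes rung: none».  References: Keller–Yin arXiv:2410.23241 Thm. 3.3.6, Prop. 3.4.4,
§3.5, Thm. 3.5.1 [KellerYin2024b]; CGLS 2022 Thms. 1.2.2, 2.1.2, 2.2.2, Prop. 14 [CastellaGrossiLeeSkinner2022]; Castella–Hsieh 2018 §3.3, Def.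
3.7, Prop. 3.8 [CastellaHsieh2018]; Hsieh 2014 Thm. A [Hsieh2014]; Liu–Zhang–Zhang 2018 Thms. 1.5.1/1.5.3 [LiuZhangZhang2018]; this seat p639xxx
(gen 21 §3–§4), p680016, p680448 (gen 26).
-/

set_option autoImplicit false
-- `Summit.<P>.<Sub>` repeats `BirchSwinnertonDyer` by the tree's layout convention (D-0017)
set_option linter.dupNamespace false

noncomputable section

open scoped Classical NumberField

open Field NumberField IsDedekindDomain WeierstrassCurve PowerSeries
  Literature.NumberTheory.EllipticCurves Literature.NumberTheory.EllipticCurves.GreenbergSelmer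
  Literature.NumberTheory.GaloisRepresentations Literature.NumberTheory.GaloisCohomology
  Literature.NumberTheory.EllipticCurves.ModularForms Literature.NumberTheory.EllipticCurves.Rank1Residual
  Literature.NumberTheory.EllipticCurves.KellerYin2024 Literature.NumberTheory.EllipticCurves.CaiShuTian2014
  Literature.NumberTheory.IwasawaTheory Literature.NumberTheory.IwasawaTheory.Greenberg2016
  Literature.NumberTheory.IwasawaTheory.Greenberg2006
  Summit.BirchSwinnertonDyer.Rank1Residual Summit.BirchSwinnertonDyer.Rank1Residual.X11b
  Summit.BirchSwinnertonDyer.Rank1Residual.X11b.AcSelmer Summit.BirchSwinnertonDyer.Rank1Residual.X11b.Halves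
  Summit.BirchSwinnertonDyer.Rank1Residual.X11b.CongruenceLimit
  Summit.BirchSwinnertonDyer.Rank1Residual.Additive
  Summit.BirchSwinnertonDyer.BirchSwinnertonDyer.Theorems.SchneiderFree
  Summit.BirchSwinnertonDyer.BirchSwinnertonDyer.Theorems.SchneiderFree.KYRead
  Summit.BirchSwinnertonDyer.BirchSwinnertonDyer.Theses.SchneiderFreeAdditiveX3
  Summit.BirchSwinnertonDyer.BirchSwinnertonDyer.Theorems.SchneiderFreeAdditiveX3.LZZMatch
  Summit.BirchSwinnertonDyer.BirchSwinnertonDyer.Theorems.SchneiderFreeAdditiveX3.ControlDischarged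
  Summit.BirchSwinnertonDyer.BirchSwinnertonDyer.Theorems.SchneiderFreeAdditiveX3.KYBranchOnly
  Summit.BirchSwinnertonDyer.BirchSwinnertonDyer.Theorems.SchneiderFreeAdditiveX3.KYBranchThree
open Literature.NumberTheory.EllipticCurves.CastellaGrossiLeeSkinner2022
  (cor126_residualCharacter_globalLift cor126_residualCharacter_localSurjective
    prop125_characterGrSelmerDual_torsion_muZero_dim prop14_residualCharacterSelmer_finite IsKatzLFunction)

namespace Summit.BirchSwinnertonDyer.BirchSwinnertonDyer.Theorems.SchneiderFreeAdditiveX3.KYBranchThreeDoor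

/-! ### §1 H3♭ᶜ at every ♭-frame of the conjugate prime, `p = 3`, non-anomalous twist, the curve itself Keller–Yin-normalised -/

/-- **H3♭ᶜ at a ♭-frame of the conjugate prime at `p = 3` ⇐ [DIV.dvd] ∧ [AN3] ∧ [BR3] ∧ Castella–Hsieh signed existence ∧ eleven published
facts ∧ the comparison data** — generation 21's `KYBranchOnly.xac_charIdeal_map_le_span_of_KY_branch_of_castellaHsieh_signed` at `p = 3` with the
good member `W₁ = W` (the presented curve `W = C₂ • ((D • W′) ⊗ χ_{−3})` ITSELF in Case (I), `W[3]` reducible, normalised lattice, `W(K)[3] = 0`;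
`W′` good at `3` with parametrisation datum `Dt′`, `3 ∤ N′`), in the (G-ord, `e = 2`) cell with the non-anomalous-twist clause, and with
Keller–Yin's KYb/KYμ replaced by `KYBranchThree.xac_charIdeal_map_eq_span_three_of_dvd` (fed by [DIV.dvd] `thm336_dvd_branch_OPEN`, [AN3]
`thm351_anacong_branch_three`, [BR3] `thm122_charLambda_pair_three`, eleven published facts, and the comparison data at `(𝔭′, ι′)`: a residual
pair `(θsub, θquot)` of `W_K[3]`, a member `θ₀` whose Hecke character `θ₀K` is unramified at `𝔭′` and `𝔭` with a Katz frame `Lφ` at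
`(ι′, 𝔭′, 𝔭)`).  Conclusion: for EVERY ♭-frame `Q` of `Dt.f` at `(ι′, 𝔭′)`, `Ch_Λ(X_ac^∅(W_K) at 𝔭)·𝓞_{ℂ_3}⟦T⟧ ⊆ (Q)` (signed frame from
Castella–Hsieh; the branch equality from §2 of `KYBranchThree`; rigidity `(L) ⊆ (Q)`).  CONDITIONAL on the named statements; nothing
asserted about BSD. [claim: KellerYin2024PotOrd, status: under-review]
[cite: KellerYin2024b, Thm. 3.5.1 and Rem. 3.5.2 (arXiv:2410.23241 p. 20) (preprint; the Kolyvagin clause a hypothesis)]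
[cite: CastellaHsieh2018, §3.3, Def. 3.7 and Prop. 3.8 (the signed branch frame)] [cite: CastellaGrossiLeeSkinner2022, Thms. 1.2.2, 2.1.2, 2.2.2, Prop. 14] -/
theorem xac_charIdeal_map_le_span_three_self_of_dvd
    (hCHσ : castellaHsieh2018_exists_isBranchBDPLFunction_signed)
    (hDVD : thm336_dvd_branch_OPEN) (hAN : thm351_anacong_branch_three) (hBR : thm122_charLambda_pair_three)
    (hprop125 : prop125_characterGrSelmerDual_torsion_muZero_dim) (hfact : prop14_residualCharacterSelmer_finite)
    (hlift : cor126_residualCharacter_globalLift) (hlocal : cor126_residualCharacter_localSurjective)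
    (h411 : prop411_selmer_isAlmostDivisible) (h263 : prop263_sur_of_crk) (h41 : prop41_globalEulerPoincareCorank)
    (h42 : prop42_localEulerPoincareCorank) (h5A : sec5A_localH2_subsingleton_of_LOC1)
    (h32 : prop32_cohomology_isCofinitelyGenerated)
    (hmodN : exists_isNewformOf)
    -- the good partner `W′`, the presentation of the door's curve at `p = 3`
    (W' : WeierstrassCurve ℚ) [W'.IsElliptic] (hgood : W'.HasGoodReductionAtPrime 3) (D C₂ : VariableChange ℚ)
    [(C₂ • (D • W').quadraticTwist ((-1 : ℚ) ^ (3 / 2) * (3 : ℕ))).IsElliptic]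
    [(C₂ • (D • W').quadraticTwist ((-1 : ℚ) ^ (3 / 2) * (3 : ℕ))).IsGloballyMinimal] {N : ℕ} [NeZero N]
    (Dt : ModularParametrizationData (C₂ • (D • W').quadraticTwist ((-1 : ℚ) ^ (3 / 2) * (3 : ℕ))) N)
    {N' : ℕ} [NeZero N'] (Dt' : ModularParametrizationData W' N') (hpN' : ¬ 3 ∣ N')
    -- the socket's field, tower, primes, embedding datum; Heegner for `N` and for the partner's level
    {K : Type} [Field K] [NumberField K] [IsGalois ℚ K] (hK : IsImaginaryQuadratic K)
    (hHe : SatisfiesHeegnerHypothesis N K) (hHe' : SatisfiesHeegnerHypothesis N' K)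
    (hodd : Odd (NumberField.discr K)) (hdK : NumberField.discr K ≠ -3)
    {κ : ZpExtension K 3} (hκ : κ.IsAnticyclotomic) (γ : absoluteGaloisGroup K) [hγ : Fact (κ.IsTopGenerator γ)]
    {𝔭 : HeightOneSpectrum (𝓞 K)} (h𝔭 : ((3 : ℕ) : 𝓞 K) ∈ 𝔭.asIdeal)
    (he : 𝔭.asIdeal.ramificationIdx (𝓞 ℚ) = 1) (hf : 𝔭.asIdeal.inertiaDeg (𝓞 ℚ) = 1)
    {𝔭' : HeightOneSpectrum (𝓞 K)} (h𝔭' : ((3 : ℕ) : 𝓞 K) ∈ 𝔭'.asIdeal) (hne : 𝔭 ≠ 𝔭')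
    {ι' : PadicAlgCl 3 ≃+* ℂ} (hι' : BranchInducesPrime 3 ι' 𝔭')
    -- the curve ITSELF carries Keller–Yin's per-curve hypotheses, lies in the (G-ord) cell, and has non-anomalous twists
    (hN : (C₂ • (D • W').quadraticTwist ((-1 : ℚ) ^ (3 / 2) * (3 : ℕ))).conductorNorm ℤ = N)
    (hcase : (C₂ • (D • W').quadraticTwist ((-1 : ℚ) ^ (3 / 2) * (3 : ℕ))).HasGoodOrdinaryReductionOverQuadraticAt 3)
    (hX : ClassX3 (C₂ • (D • W').quadraticTwist ((-1 : ℚ) ^ (3 / 2) * (3 : ℕ))) 3)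
    (hSG : SubGordTwo (C₂ • (D • W').quadraticTwist ((-1 : ℚ) ^ (3 / 2) * (3 : ℕ))) 3)
    (hna : ∀ (V : WeierstrassCurve ℚ) [V.IsElliptic] [V.IsGloballyMinimal] (C : VariableChange ℚ),
      GoodOrd V 3 → C • V.quadraticTwist ((-1 : ℚ) ^ (3 / 2) * (3 : ℕ)) =
        C₂ • (D • W').quadraticTwist ((-1 : ℚ) ^ (3 / 2) * (3 : ℕ)) → ¬ (3 : ℤ) ∣ V.frobeniusTrace 3 - 1)
    (hlat : ∃ Φ : AddSubgroup (geomTorsion (C₂ • (D • W').quadraticTwist ((-1 : ℚ) ^ (3 / 2) * (3 : ℕ))) (3 : ℤ)),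
      IsRationalLine (C₂ • (D • W').quadraticTwist ((-1 : ℚ) ^ (3 / 2) * (3 : ℕ))) 3 Φ ∧
        ¬ LineDecompositionTrivialAt (C₂ • (D • W').quadraticTwist ((-1 : ℚ) ^ (3 / 2) * (3 : ℕ))) 3 Φ)
    (htf : ∀ Q : ((C₂ • (D • W').quadraticTwist ((-1 : ℚ) ^ (3 / 2) * (3 : ℕ))).baseChange K).toAffine.Point, 3 • Q = 0 → Q = 0)
    -- the analytic comparison data at `(𝔭′, 𝔭, ι′)`
    {θsub θquot : FramedGaloisRep K (padicCoeffIntegers (∅ : Set (PadicAlgCl 3))) 1}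
    (hpair : IsResidualPairOver ((C₂ • (D • W').quadraticTwist ((-1 : ℚ) ^ (3 / 2) * (3 : ℕ))).baseChange K) 3 θsub θquot)
    {θ₀ : FramedGaloisRep K (padicCoeffIntegers (∅ : Set (PadicAlgCl 3))) 1} (hθ₀ : θ₀ = θsub ∨ θ₀ = θquot)
    {θ₀K : HeckeCharacter K} (hθ₀K : IsHeckeCharOf ι' θ₀ θ₀K) (hv0 : θ₀K.IsUnramifiedAt 𝔭') (hvbar0 : θ₀K.IsUnramifiedAt 𝔭)
    {Cbar : Finset (HeightOneSpectrum (𝓞 K))} (hCbar : ∀ u ∈ Cbar, ¬ θ₀K.IsUnramifiedAt u)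
    {ΩK₀ : ℂ} {Ωp₀ : (unrIntegers 3)ˣ} {Lφ : UnrSeries 3} (hΩK₀ : ΩK₀ ≠ 0)
    (hLφ : IsKatzLFunction ι' 𝔭' 𝔭 Cbar κ γ θ₀K ΩK₀ ((Ωp₀ : unrIntegers 3) : ℂ_[3]) Lφ)
    -- the ♭-frame at the conjugate prime
    {ΩK' : ℂ} {Ωp' : ℂ_[3]} {Q : PowerSeries (PadicComplexInt 3)} (hΩK' : ΩK' ≠ 0) (hΩp' : Ωp' ≠ 0)
    (hQ : R1.IsBDPLFunctionInt 3 ι' 𝔭' κ γ Dt.f ΩK' Ωp' Q) :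
    (XAc.charIdeal ((C₂ • (D • W').quadraticTwist ((-1 : ℚ) ^ (3 / 2) * (3 : ℕ))).baseChange K) 3 κ 𝔭 ∅ γ).map
        (PowerSeries.map (R1.toCpInt 3)) ≤ Ideal.span {Q} := by
  have hp2 : (3 : ℕ) ≠ 2 := by norm_num
  have hsplit : ((Ideal.span {((3 : ℕ) : ℤ)}).primesOver (𝓞 K)).ncard = 2 :=
    ncard_primesOver_eq_two_of_degreeOne hK.1 h𝔭 he hf
  -- the conductor exponent of `χ_ε` above the split prime `3` is `1` (Literature theorem)
  have hcond : ∀ 𝔮 : HeightOneSpectrum (𝓞 K), ((3 : ℕ) : 𝓞 K) ∈ 𝔮.asIdeal →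
      (KellerYin2024.genusHeckeCharacter K 3).HasConductorExponentAt 𝔮 1 := fun 𝔮 h𝔮 ↦
    KellerYin2024.genusHeckeCharacter_hasConductorExponentAt_one_of_split K 3 hp2 hK hsplit h𝔮
  -- step 1: the SIGNED branch frame of `(Dt′.f, χ_ε)` at `𝔭′` (Castella–Hsieh, published)
  obtain ⟨e, ΩK, Ωp, L, hesign, hΩK, hL⟩ := hCHσ ι' W' K 𝔭' κ γ Dt'.isNewformOf (KellerYin2024.genusHeckeCharacter K 3) hp2
    hpN' hK hodd hdK hsplit h𝔭' hι' hHe' hκ hγ.out (KellerYin2024.genusHeckeCharacter_sq K 3)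
    (fun w hw ↦ KellerYin2024.genusHeckeCharacter_isUnramifiedAt K 3 hw) hcond
  have hΩp : ((Ωp : unrIntegers 3) : ℂ_[3]) ≠ 0 := by
    rw [Ne, ZeroMemClass.coe_eq_zero]
    exact Ωp.ne_zero
  -- step 2: Keller–Yin's standing data for the curve itself, at `(v, v̄) = (𝔭′, 𝔭)`, and the twist relation
  have hS : PotOrdSetting ι' (C₂ • (D • W').quadraticTwist ((-1 : ℚ) ^ (3 / 2) * (3 : ℕ))) K 𝔭' 𝔭 κ N :=
    potOrdSetting_of_socketData hp2 ι' _ K 𝔭 𝔭' κ N hN hcase hX.1 hlat htf hK hHe hodd hdK hκ h𝔭 he hf hne hι'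
  have htw : ∃ S : Finset ℕ, ∀ ℓ : ℕ, ℓ.Prime → ℓ ∉ S →
      cuspCoeff Dt.f ℓ = ((legendreSym 3 ℓ : ℤ) : ℂ) * cuspCoeff Dt'.f ℓ :=
    exists_cofinite_cuspCoeff_eq_legendreSym_mul hp2 W' D C₂ Dt Dt'
  -- step 3: Keller–Yin Thm. 3.5.1 (branch currency) at `p = 3` from [DIV.dvd] + [AN3] + [BR3] + published facts
  have heq := (xac_charIdeal_map_eq_span_three_of_dvd hAN hBR hprop125 hfact hlift hlocal h411 h263 h41 h42 h5A h32 hDVD ι'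
    _ K 𝔭' 𝔭 κ γ Dt.isNewformOf hS hX hSG hna h𝔭' Dt'.isNewformOf.1 hpN' htw hpair hθ₀ hθ₀K hv0 hvbar0 hCbar hΩK₀ hLφ hesign
    hΩK hL (toUnr 3) (coe_toUnr 3)).1
  have hdiv : (XAc.charIdeal ((C₂ • (D • W').quadraticTwist ((-1 : ℚ) ^ (3 / 2) * (3 : ℕ))).baseChange K) 3 κ 𝔭 ∅ γ).map
      (PowerSeries.map (toUnr 3)) ≤ Ideal.span {L} := by
    rw [xac_charIdeal_eq_literature, heq]
  -- step 4: rigidity — `(L) ⊆ (Q)` since the constant `ι′⁻¹(±1)` is integral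
  have hKp : Algebra.IsUnramifiedIn (𝓞 K) (Ideal.span {((3 : ℕ) : ℤ)}) := isUnramifiedIn_of_splitsTwo hK hsplit
  obtain ⟨c, hc, -⟩ := exists_coe_eq_symm_of_sign (p := 3) (ι := ι') hesign
  have hLQ : Ideal.span {PowerSeries.map (R1.unrToCpInt 3) L} ≤ Ideal.span {Q} :=
    span_map_le_span_of_isBranchBDPLFunction_of_isBDPLFunctionInt hp2 hK hKp Dt.f Dt'.f
      (fun _ hℓ hℓp ↦ cuspCoeff_eq_legendreSym_mul_of_presentation hp2 W' D C₂ Dt.isNewformOf Dt'.isNewformOf hℓ hℓp)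
      (cuspCoeff_prime_eq_zero_of_presentation hp2 W' hgood D C₂ Dt)
      (prime_dvd_level_of_presentation hmodN hp2 W' hgood D C₂ Dt)
      (fun _ hℓ hℓp ↦ dvd_level_iff_dvd_level_partner_of_presentation hmodN hp2 W' hgood D C₂ Dt Dt' hℓ hℓp)
      hκ hγ.out hΩK hΩK' hΩp hΩp' hL hQ hc
  exact (map_toCpInt_le_span_of_map_toUnr_le_span hdiv).trans hLQ


/-! ### §2 The (G-ord, `e = 2`) lower socket at `p = 3` off the sliver, per datum, for a Keller–Yin-normalised curve with non-anomalous twists -/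

/-- **The (G-ord, `e = 2`) lower socket AT `p = 3`, OFF the `d_K = −3` sliver, for a Keller–Yin-normalised curve with non-anomalous twists ⇐
Kolyvagin ∧ modularity ∧ Hsieh 2014 Thm. A ∧ Liu–Zhang–Zhang 2018 ∧ Castella–Hsieh signed ∧ [DIV.dvd] ∧ [AN3] ∧ [BR3] ∧ eleven published facts
∧ the comparison data (`hAUX`)** — generation 21's `KYBranchOnly.additiveIMCLowerBDPOnTree_subGordTwo_offSliver_of_hsieh_of_lzz_of_KY_branch_of_castellaHsieh_signed`
at `p = 3` with Keller–Yin's two clauses KYb, KYμ REPLACED by [DIV.dvd] + [AN3] + [BR3] + published facts (§1), for curves `W` that are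
themselves Keller–Yin-normalised at the datum's field (`hlat`: a rational `3`-line non-trivial on the decomposition groups at `3`; `htf`:
`W(K)[3] = 0`) — no isogeny descent —, in the (G-ord) cell with the non-anomalous-twist clause, and GIVEN, at every conjugate degree-one prime
`𝔮 ∋ 3` and every embedding datum inducing it, the analytic comparison data (`hAUX`: a residual pair of `W_K[3]`, a member with a Hecke character
unramified above `3` and a Katz frame of it — existence statements of the tree / CGLS Thm. 2.1.2, displayed).  At every Heegner datum of such
a pair `(W, 3)` with `d_K ≠ −3` and every anticyclotomic frame `(κ, γ, 𝔭)`: `AdditiveIMCLowerBDPOnTreeLeAt 3 κ 𝔭 γ ι_𝔭 (v_3 c) P`.  CONDITIONAL on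
the displayed hypotheses; nothing asserted about BSD. [claim: KellerYin2024PotOrd, status: under-review]
[cite: KellerYin2024b, Thm. 3.3.6, Prop. 3.4.4, Thm. 3.5.1, Rem. 3.5.2, Assumption 2.0.3 (arXiv:2410.23241 pp. 8, 19–20) (preprint; the Kolyvagin clause a hypothesis)]
[cite: CastellaHsieh2018, §3.3, Def. 3.7 and Prop. 3.8] [cite: Hsieh2014, Thm. A p. 712 (Doc. Math. 19)]
[cite: LiuZhangZhang2018, Thm 1.5.1 and Thm 1.5.3 (Duke Math. J. 167 pp. 748–749)] [cite: CastellaGrossiLeeSkinner2022, Thms. 1.2.2, 2.1.2, 2.2.2, Prop. 14] -/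
theorem additiveIMCLowerBDPOnTree_subGordTwo_three_offSliver_self
    (hKo : ∀ (N : ℕ) [NeZero N] (W : WeierstrassCurve ℚ) (K : Type) [Field K] [NumberField K],
      Literature.NumberTheory.EllipticCurves.kolyvagin N W K)
    (hPar : nonempty_modularParametrizationData)
    (hA : Hsieh2014.thmA_exists_isHsiehLFunction_unrPeriod_anyLevel)
    (hL : LiuZhangZhang2018.thm151_thm153_modularCurve_heegnerVector_additive)
    (hCHσ : castellaHsieh2018_exists_isBranchBDPLFunction_signed)
    (hDVD : thm336_dvd_branch_OPEN) (hAN : thm351_anacong_branch_three) (hBR : thm122_charLambda_pair_three)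
    (hprop125 : prop125_characterGrSelmerDual_torsion_muZero_dim) (hfact : prop14_residualCharacterSelmer_finite)
    (hlift : cor126_residualCharacter_globalLift) (hlocal : cor126_residualCharacter_localSurjective)
    (h411 : prop411_selmer_isAlmostDivisible) (h263 : prop263_sur_of_crk) (h41 : prop41_globalEulerPoincareCorank)
    (h42 : prop42_localEulerPoincareCorank) (h5A : sec5A_localH2_subsingleton_of_LOC1)
    (h32 : prop32_cohomology_isCofinitelyGenerated) :
    ∀ (W : WeierstrassCurve ℚ) [W.IsElliptic] [W.IsGloballyMinimal],
      W.analyticRank = 1 → ClassX3 W 3 → SubGordTwo W 3 →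
      (∀ (V : WeierstrassCurve ℚ) [V.IsElliptic] [V.IsGloballyMinimal] (C : VariableChange ℚ),
        GoodOrd V 3 → C • V.quadraticTwist ((-1 : ℚ) ^ (3 / 2) * (3 : ℕ)) = W → ¬ (3 : ℤ) ∣ V.frobeniusTrace 3 - 1) →
      (∃ Φ : AddSubgroup (geomTorsion W (3 : ℤ)), IsRationalLine W 3 Φ ∧ ¬ LineDecompositionTrivialAt W 3 Φ) →
      ∀ (N : ℕ) [NeZero N] (K : Type) [Field K] [NumberField K]
        (Dt : ModularParametrizationData W N) (H : HeegnerDatum N (NumberField.discr K)) (ι : K →+* ℂ)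
        (P : (W.baseChange K).toAffine.Point),
        W.analyticRank = 1 → Additive.N10.Locus W 3 → W.conductorNorm ℤ = N → IsImaginaryQuadratic K →
        Odd (NumberField.discr K) → ¬ 3 ∣ Units.torsionOrder K → SatisfiesHeegnerHypothesis N K →
        (W.quadraticTwist (NumberField.discr K : ℚ)).entireLFunction 1 ≠ 0 →
        WeierstrassCurve.Affine.Point.map ι.toRatAlgHom P = heegnerPointComplex Dt H →
        ¬ IsOfFinAddOrder P → NumberField.discr K ≠ -3 →
        (∀ Q : (W.baseChange K).toAffine.Point, 3 • Q = 0 → Q = 0) →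
        ∀ (κ : ZpExtension K 3), κ.IsAnticyclotomic →
          ∀ (γ : Field.absoluteGaloisGroup K) [Fact (κ.IsTopGenerator γ)]
            (𝔭 : HeightOneSpectrum (𝓞 K)) (h𝔭 : ((3 : ℕ) : 𝓞 K) ∈ 𝔭.asIdeal)
            (he : 𝔭.asIdeal.ramificationIdx (𝓞 ℚ) = 1) (hf : 𝔭.asIdeal.inertiaDeg (𝓞 ℚ) = 1),
            -- the analytic comparison data at every conjugate prime and every embedding datum inducing it (AUX3)
            (∀ (𝔮 : HeightOneSpectrum (𝓞 K)), ((3 : ℕ) : 𝓞 K) ∈ 𝔮.asIdeal → 𝔭 ≠ 𝔮 →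
              ∀ (ι' : PadicAlgCl 3 ≃+* ℂ), BranchInducesPrime 3 ι' 𝔮 →
                ∃ (θsub θquot θ₀ : FramedGaloisRep K (padicCoeffIntegers (∅ : Set (PadicAlgCl 3))) 1)
                  (θ₀K : HeckeCharacter K) (Cbar : Finset (HeightOneSpectrum (𝓞 K)))
                  (ΩK₀ : ℂ) (Ωp₀ : (unrIntegers 3)ˣ) (Lφ : UnrSeries 3),
                  IsResidualPairOver (W.baseChange K) 3 θsub θquot ∧ (θ₀ = θsub ∨ θ₀ = θquot) ∧
                    IsHeckeCharOf ι' θ₀ θ₀K ∧ θ₀K.IsUnramifiedAt 𝔮 ∧ θ₀K.IsUnramifiedAt 𝔭 ∧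
                    (∀ u ∈ Cbar, ¬ θ₀K.IsUnramifiedAt u) ∧ ΩK₀ ≠ 0 ∧
                    IsKatzLFunction ι' 𝔮 𝔭 Cbar κ γ θ₀K ΩK₀ ((Ωp₀ : unrIntegers 3) : ℂ_[3]) Lφ) →
            AdditiveIMCLowerBDPOnTreeLeAt 3 κ 𝔭 γ (embAt K 3 𝔭 h𝔭 he hf) (padicValNat 3 Dt.c.natAbs) P := by
  intro W _ _ hr hX hS hna hlat
  have hp2 : (3 : ℕ) ≠ 2 := by norm_num
  -- present the door's curve through its good-ordinary partner
  obtain ⟨W', hE', hmin', C₂, hW, hord, hΔ⟩ :=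
    exists_goodOrd_partner_presentation_of_subGordTwo_odd hp2 W hX hS
  subst hW
  haveI : NeZero (W'.conductorNorm ℤ) := ⟨(WeierstrassCurve.conductorNorm_pos_holds W').ne'⟩
  intro N _ K _ _ Dt H ι P hr' hloc hN hK hodd hunit hHe hL1 hP hnt hdK htf κ hκ γ _ 𝔭 h𝔭 he hf hAUX
  refine additiveIMCLowerBDPOnTreeLeAt_of_kolyvagin_of_hsieh_of_lzz_of_intDivConj hKo hA hL hp2 hX (Or.inr hS) Dt H ι P
    hr' hloc hN hK hodd hunit hHe hL1 hP hnt κ hκ γ 𝔭 h𝔭 he hf ?_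
  intro 𝔮 h𝔮 hne he' hf' ι' hι' ΩK Ωp Q hΩK hΩp hQ
  -- a parametrisation datum of the partner; `K/ℚ` is Galois
  obtain ⟨Dt'⟩ := hPar W'
  haveI : IsGalois ℚ K := Literature.FieldTheory.Galois.isGalois_of_finrank_eq_two hK.1
  -- the partner's level is prime to `3` and inherits the Heegner hypothesis (`N_{W′} ∣ N`)
  have hpN' : ¬ 3 ∣ W'.conductorNorm ℤ := not_dvd_conductorNorm_of_hasGoodReductionAtPrime W' hord.1
  have hmodN : exists_isNewformOf := exists_isNewformOf_of_nonempty_modularParametrizationData hPar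
  have hHe' : SatisfiesHeegnerHypothesis (W'.conductorNorm ℤ) K :=
    SatisfiesHeegnerHypothesis.of_dvd (conductorNorm_partner_dvd_level hmodN hp2 W' hord.1 _ C₂ Dt) hHe
  -- Case (I) for the curve itself, from the cell
  have hcase := hasGoodOrdinaryReductionOverQuadraticAt_of_subGordTwo hp2 _ hX hS
  -- the comparison data at `(𝔮, ι′)`
  obtain ⟨θsub, θquot, θ₀, θ₀K, Cbar, ΩK₀, Ωp₀, Lφ, hpair, hθ₀, hθ₀K, hv0, hvbar0, hCbar, hΩK₀, hLφ⟩ := hAUX 𝔮 h𝔮 hne ι' hι'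
  exact xac_charIdeal_map_le_span_three_self_of_dvd hCHσ hDVD hAN hBR hprop125 hfact hlift hlocal h411 h263 h41 h42 h5A h32 hmodN
    W' hord.1 _ C₂ Dt Dt' hpN' hK hHe hHe' hodd hdK hκ γ h𝔭 he hf h𝔮 hne hι' hN hcase hX hS hna hlat htf hpair hθ₀ hθ₀K hv0 hvbar0
    hCbar hΩK₀ hLφ hΩK hΩp hQ

end Summit.BirchSwinnertonDyer.BirchSwinnertonDyer.Theorems.SchneiderFreeAdditiveX3.KYBranchThreeDoor

end
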